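import Summits.RiemannHypothesis.RiemannHypothesis.Theorems.S2FormatCBridge
import Literature.NumberTheory.LFunctions.YoshidaWindowGramEnclosure
import Literature.NumberTheory.LFunctions.WeilMarkovTwoPrime
import HarnessLib

/-!
# Format C at `S = {∞, 2}` — the `{∞,2}` Gram matrix in Yoshida's vocabulary (junction with the ONE (E) evaluator)

Seat cc-s2-4 gen3 (`HOME/cc-s2-4/CC4-LEAN.md` §9.11; lead ruling R7-22 (1)(i), joint line with weil-2, choice (α):
one entry evaluator for all format-C rungs, weil-2's `Yoshida1992.Encl.gramBox` on the list form of Yoshida's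
coefficients).  The closed-form `{∞,2}` Gram matrix `S2FormatC.gram b` of `S2FormatCDefs` (the matrix of the `{∞,2}`
window form, `EntryTheoremTwo`, proved in `S2FormatCBridge`) is, block by block, Yoshida's (5.15)/(5.16) with the
prime sum restricted to the single length `log 2`:

* `polarG_eq_polarCoeff`, `primeG_eq_incrCoeff` (`primeG = Λ·(K_{log 2} − 2δ)`, `Λ = log 2/√2`),
  `archExpSumSin_eq` / `archExpSumDiag_eq` (weil-2's separated exponential sums are `ω·S0` and `Sdiag`),
  `archG_sub_eq_archCoeff` (`archG − (log π)δ = archCoeff`, `0 < b`);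
* **`gram_eq_yoshida`**: `gram b n m = polarCoeff b n m + Λ·(incrCoeff b (log 2) n m − 2δ_{nm}) + archCoeff b n m`
  (`0 < b`), and `gram_eq_listSum`: the same with the prime part written as the list sum over `[⟨2, 1⟩]` — literally the
  body of weil-2's `gramCoeffList b [⟨2,1⟩] n m`, so the diagonal shift of the joint line is `κ = 0`;
* versus the FULL Weil matrix: `gramCoeff_eq_gram_add_three` (`(log 3)/2 < b ≤ log 2`: `gramCoeff = gram +
  (log 3/√3)(K_{log 3} − 2δ)`) and `gramCoeff_eq_gram` (`(log 2)/2 < b ≤ (log 3)/2`: the `{∞,2}` matrix IS the Weil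
  matrix — no prime other than `2` has length `< 2b`).
Elementary algebra on closed forms; standard axioms; infrastructure only, no claim about RH.
-/

set_option linter.dupNamespace false
set_option autoImplicit false

noncomputable section

open Complex Set MeasureTheory Filter Finset
open scoped Real Topology ComplexConjugate BigOperators ArithmeticFunction.vonMangoldt

namespace Summit.RiemannHypothesis.RiemannHypothesis.Theorems.S2FormatC

open Literature.NumberTheory.LFunctions Literature.Analysis.SpecialFunctions
open Literature.NumberTheory.LFunctions.Yoshida1992 (freq polarCoeff incrCoeff primeCoeff archCoeff gramCoeff
  archExpSumSin archExpSumDiag PrimeLen)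

section GramYoshida

variable {b : ℝ}

/-- The window frequencies agree: `ω_n = freq b n`. -/
theorem omega_eq_freq (b : ℝ) (n : ℤ) : omega b n = freq b n := rfl

/-- **Polar block**: `polarG = polarCoeff` (Yoshida (5.1)). -/
theorem polarG_eq_polarCoeff (b : ℝ) (n m : ℤ) : polarG b n m = polarCoeff b n m := by
  unfold polarG polarCoeff sSq omega freq
  rw [sgn_eq_zpow]
  ring

/-- **Prime block**: `primeG = Λ·(K_{log 2} − 2δ)` with `Λ = log 2/√2` and `K_t = incrCoeff b t` the increment kernel. -/
theorem primeG_eq_incrCoeff (b : ℝ) (n m : ℤ) :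
    primeG b n m = lam * (incrCoeff b (Real.log 2) n m - if n = m then 2 else 0) := by
  unfold primeG incrCoeff lam omega freq
  by_cases h : n = m
  · simp only [h, if_true]; ring
  · simp only [h, if_false]; rw [sgn_sub_eq, sgn_eq_zpow]; ring

/-- weil-2's separated off-diagonal exponential sum is `ω_n·S0_n`. -/
theorem archExpSumSin_eq (b : ℝ) (n : ℤ) : archExpSumSin b n = omega b n * S0 b n := by
  unfold archExpSumSin freq
  exact tsum_T_eq b n

/-- weil-2's diagonal exponential sum is `Sdiag_n`. -/
theorem archExpSumDiag_eq (b : ℝ) (n : ℤ) : archExpSumDiag b n = Sdiag b n := by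
  unfold archExpSumDiag freq
  exact tsum_diag_eq b n

/-- **Archimedean block** (`0 < b`): `archG − (log π)·δ = archCoeff` (the partial-fraction identity `expsumOff_eq`
turns the product form of (5.16) into weil-2's separated form). -/
theorem archG_sub_eq_archCoeff (hb : 0 < b) (n m : ℤ) :
    archG b n m - (if n = m then Real.log π else 0) = archCoeff b n m := by
  unfold archCoeff
  rw [archExpSumSin_eq, archExpSumSin_eq, archExpSumDiag_eq]
  have hπ : π ≠ 0 := Real.pi_pos.ne'
  have hb0 : b ≠ 0 := hb.ne'
  unfold archG
  by_cases h : n = m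
  · subst h
    simp only [if_true]
    unfold rePsi rePsi' omega freq
    field_simp
    ring
  · simp only [h, if_false, sub_zero]
    rw [expsumOff_eq hb h, sgn_eq_zpow]
    unfold imPsi omega freq
    have hnm : (n : ℝ) - m ≠ 0 := sub_ne_zero.2 (by exact_mod_cast h)
    have hω : π * n / b - π * m / b = π * (n - m) / b := by ring
    rw [hω]
    field_simp
    ring

/-- **The `{∞,2}` Gram matrix in Yoshida's vocabulary** (`0 < b`):
`G₂(n,m) = polarCoeff + Λ·(K_{log 2} − 2δ) + archCoeff`. -/
theorem gram_eq_yoshida (hb : 0 < b) (n m : ℤ) :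
    gram b n m = polarCoeff b n m + lam * (incrCoeff b (Real.log 2) n m - if n = m then 2 else 0) +
      archCoeff b n m := by
  rw [← archG_sub_eq_archCoeff hb, ← primeG_eq_incrCoeff, ← polarG_eq_polarCoeff]
  unfold gram
  ring

/-- The single prime length of the `{∞,2}` form as weil-2's `PrimeLen` record: `ℓ = 1·log 2`. -/
theorem primeLen_two_len : (⟨2, 1⟩ : PrimeLen).len = Real.log 2 := by
  unfold PrimeLen.len; push_cast; ring

/-- Its weight `log 2 · e^{−(log 2)/2} = log 2/√2 = Λ`. -/
theorem primeLen_two_wt : (⟨2, 1⟩ : PrimeLen).wt = lam := by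
  unfold PrimeLen.wt lam
  rw [primeLen_two_len]
  have h2 : Real.exp (-(Real.log 2 / 2)) = 1 / Real.sqrt 2 := by
    rw [Real.exp_neg, show Real.log 2 / 2 = Real.log 2 * (1 / 2) by ring, Real.exp_mul, Real.exp_log two_pos,
      ← Real.sqrt_eq_rpow, one_div]
  rw [h2]
  push_cast
  ring

/-- **The list form** (`0 < b`): `gram b n m` is LITERALLY the body of weil-2's `gramCoeffList b [⟨2, 1⟩] n m`
(polar + the prime list sum over the one record `⟨2,1⟩` + arch) — the junction identity of the joint line R7-22 (1)(i),
with diagonal shift `κ = 0`. -/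
theorem gram_eq_listSum (hb : 0 < b) (n m : ℤ) :
    gram b n m = polarCoeff b n m +
      (([⟨2, 1⟩] : List PrimeLen).map fun q ↦ q.wt * (incrCoeff b q.len n m - if n = m then 2 else 0)).sum +
        archCoeff b n m := by
  rw [gram_eq_yoshida hb, List.map_singleton, List.sum_singleton, primeLen_two_wt, primeLen_two_len]

/-! ### Versus the full Weil matrix `gramCoeff` (all prime lengths `< 2b`) -/

/-- On the one-prime range `(log 2)/2 < b ≤ (log 3)/2` the window's prime sum is its `n = 2` term. -/
theorem sum_weilPrimeIndex_eq_onePrime (hb : Real.log 2 / 2 < b) (hb2 : b ≤ Real.log 3 / 2) (F : ℕ → ℝ) :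
    ∑ n ∈ weilPrimeIndex b, (Λ n : ℝ) / Real.sqrt n * F n = Real.log 2 / Real.sqrt 2 * F 2 := by
  classical
  have h2 : 2 ∈ weilPrimeIndex b := by rw [mem_weilPrimeIndex]; push_cast; linarith
  rw [← Finset.sum_subset (Finset.singleton_subset_iff.2 h2) fun n hn hns ↦ by
      rw [Finset.mem_singleton] at hns
      rw [mem_weilPrimeIndex] at hn
      have hΛ : (Λ n : ℝ) = 0 := by
        rcases Nat.lt_or_ge n 3 with h3 | h3
        · interval_cases n
          · simp
          · simp
          · exact absurd rfl hns
        · exfalso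
          have hlog : Real.log 3 ≤ Real.log n := Real.log_le_log (by norm_num) (by exact_mod_cast h3)
          linarith
      rw [hΛ, zero_div, zero_mul],
    Finset.sum_singleton, ArithmeticFunction.vonMangoldt_apply_prime Nat.prime_two]
  push_cast
  rfl

/-- **One-prime range**: for `(log 2)/2 < b ≤ (log 3)/2` the `{∞,2}` Gram matrix IS Yoshida's full Weil matrix,
`gramCoeff b = gram b` (no prime power other than `2` has length `< 2b`). -/
theorem gramCoeff_eq_gram (hb : Real.log 2 / 2 < b) (hb2 : b ≤ Real.log 3 / 2) (n m : ℤ) :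
    gramCoeff b n m = gram b n m := by
  have hb0 : 0 < b := lt_trans (div_pos (Real.log_pos one_lt_two) two_pos) hb
  rw [gram_eq_yoshida hb0, gramCoeff, primeCoeff,
    sum_weilPrimeIndex_eq_onePrime hb hb2 (fun k ↦ incrCoeff b (Real.log k) n m - if n = m then 2 else 0), lam]
  push_cast
  ring

/-- **Two-prime range**: for `(log 3)/2 < b ≤ log 2` (where `a*({2})` lives) the full Weil matrix is the `{∞,2}`
matrix plus the prime-`3` increment block: `gramCoeff b n m = gram b n m + (log 3/√3)·(K_{log 3}(n,m) − 2δ_{nm})`. -/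
theorem gramCoeff_eq_gram_add_three (hb : Real.log 3 / 2 < b) (hb2 : b ≤ Real.log 2) (n m : ℤ) :
    gramCoeff b n m = gram b n m +
      Real.log 3 / Real.sqrt 3 * (incrCoeff b (Real.log 3) n m - if n = m then 2 else 0) := by
  have hb0 : 0 < b := lt_trans (div_pos (Real.log_pos (by norm_num)) two_pos) hb
  rw [gram_eq_yoshida hb0, gramCoeff, primeCoeff,
    sum_weilPrimeIndex_eq_twoPrime hb hb2 (fun k ↦ incrCoeff b (Real.log k) n m - if n = m then 2 else 0), lam]
  push_cast
  ring

end GramYoshida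

end Summit.RiemannHypothesis.RiemannHypothesis.Theorems.S2FormatC

end
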